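import Literature.Geometry.Kaehler.RiemannSurfaceIsotypicDecomposition
import Literature.Geometry.Kaehler.RiemannSurfaceIntermediateOrbitSurfacesGenus
import Literature.Geometry.Kaehler.RiemannSurfaceHurwitzFormulaCanonical
import Literature.Geometry.Kaehler.RiemannSurfaceQuotientLift
import Literature.Geometry.Kaehler.RiemannSurfaceFixedPointsExactStabilizer
import HarnessLib

/-!
# Which isotypical components of `H¹(M)` vanish when `g(M/G) = 1`: `m_χ + m_χ̄ = 0` iff every stabilizer lies in
# `ker χ` iff `M/ker χ → M/G` is unramified iff `g(M/ker χ) = 1` (Rojas 2007, Corollary 5.13, for an ARBITRARY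
# irreducible `χ`; the remarks after Theorem 5.12)

Layer `Literature/Geometry/Kaehler`, namespace `Literature.Geometry.Kaehler.RiemannSurface` (lane `lit-hodgefound`,
Track 2, seat p04, generation 41, row g41-#2).  Sequel of `RiemannSurfaceIsotypicDecomposition` (the rational
multiplicity `m_χ + m_χ̄ = 2|G|⁻¹Σ_G χ + 2χ(1)(γ − 1) + Σ_t (χ(1) − |G_t|⁻¹Σ_{G_t} χ)`, Rojas (5.4)), of
`RiemannSurfaceIntermediateOrbitSurfacesGenus` (`f_{K,H} : M/K → M/H` is unramified iff `K` contains every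
stabilizer; the Hurwitz formula for `f_{K,H}`) and of `RepresentationTheory/FiniteGroups/IsotypicComponents`
(`|N|⁻¹Σ_N χ = χ(1) ⟺ χ(n) = χ(1)` on `N`).  The tree has the CYCLIC-quotient / linear-character case of the same
phenomenon (`RiemannSurfaceChevalleyWeilPositivity` §2, `RiemannSurfacePrimitivePrymPositivity`: Kopeliovich–Zemel
Cor. 7.4, «except when `g_{Y_Q} = g_S = 1`»); here `χ` is an arbitrary complex irreducible character, as in Rojas.
Everything is PROVED; no definition, no instance, no named fact (net Literature debt `0`).

## Source, verbatim

A. M. Rojas, *Group actions on Jacobian varieties*, Rev. Mat. Iberoam. **23** (2007) (held `paper:doi-10-4171-rmi-500`),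
p. 416–417: «It follows immediately from (5.10) that if `γ ≥ 2`, then the dimension of each subvariety `B_i` in the
`G`-equivariant decomposition of `JS` is positive, a result already obtained in [9]. If `γ = 0`, then we know that at
least the dimension of `B_1` (corresponding to the trivial representation of `G`) is zero. In our next result we
analyze the case `γ = 1`. **Corollary 5.13.** In the notation of Theorem 5.12, assume that `γ = 1`. Consider `B_i` a
subvariety associated to a non trivial representation `W_i`, and `U_i` a complex irreducible representation associated
to `W_i`. Then the following conditions are equivalent. 1. The dimension of `B_i` is `0`; 2. `C_k ⊆ ker(U_i)` for all
`k = 1, …, t`; 3. the covering `π^{ker U_i} : S/ker U_i → S/G` is unramified; 4. the genus of `S/ker U_i` is `1`.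
Moreover, if `dim B_i = 0` then the degree of `U_i` is `1`. *Proof.* Suppose `dim(B_i) = 0`. Then from equation (5.10)
we obtain that `dim(U_i) = dim Fix_{G_k}(U_i)` for all `G_k`. Therefore `G_k ≤ ker(U_i)` for all `k`. As `ker(U_i)` is
a normal subgroup of `G`, `G_k^l ≤ ker(U_i)` for all `l ∈ G`, and we obtain (2). Furthermore, the ramification divisors
for the coverings `π_G : S → S/G` and `π_{ker(U_i)} : S → S/ker(U_i)` coincide, and therefore the covering
`π^{ker U_i} : S/ker U_i → S/G` is unramified. Computing Riemann-Hurwitz for this covering, we obtain that the genus of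
`S/ker(U_i)` is one. […]», with (5.10) `dim B_i = k_i (dim U_i (γ − 1) + ½ Σ_k (dim U_i − dim Fix_{G_k} U_i))` and
(5.9) `e_i = (2 dim(U_i)(γ − 1) + Σ_k (dim U_i − dim Fix_{G_k} U_i))/ℓ_i`.

## Dictionary

`S = M`, `G ≤ Aut M` finite, `γ = g(M/G)`, `χ = χ_{U_i} ∈ Irr(G)`, `χ ≠ 1`.  At the level of `T_0`, `dim B_i = 0` is
`2 dim B_i·(dim U_i/ℓ_i) = dim (H¹)_{W_i} = [K_i:ℚ]·χ(1)·(m_χ + m_χ̄) = 0` (`RiemannSurfaceRationalCharacterCyclicQuotients`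
§5), i.e. the RATIONAL MULTIPLICITY `m_χ + m_χ̄ = ⟨χ, χ_{𝓗¹}⟩ + ⟨χ̄, χ_{𝓗¹}⟩` vanishes, equivalently
`dim 𝓗¹(M)_χ + dim 𝓗¹(M)_χ̄ = 0`; «`C_k ⊆ ker(U_i)` for all `k`» is `χ(h) = χ(1)` for every `h` in every stabilizer
`G_P` (the types `C_k` are the conjugacy classes of the non-trivial stabilizers); `ker U_i` is the subgroup
`N = {g : χ(g) = χ(1)}` (Isaacs, Lemma 2.19), entered as a subgroup `N ≤ G` with `g ∈ N ⟺ χ(g) = χ(1)`; the cover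
`S/ker U_i → S/G` is the factor map `OrbitSurface.factor N : M/N → M/G`, unramified iff its ramification divisor
vanishes; `g(S/ker U_i)` is `arithGenus (OrbitSurface ↥N M)`, identified with the tree's other currency
`arithGenus (OrbitSurface ↥(N.map G.subtype) M)` by `arithGenus_orbitSurface_subgroup_eq_map` (§0).

## What is proved

* §0 `arithGenus_orbitSurface_subgroup_eq_map` (the two intermediate-quotient currencies `M/N`, `N ≤ G ≤ Aut M`, have the
  same genus — the identity of `M` descends to a holomorphic bijection).
* §1 (any `γ`): `card_inv_mul_sum_eq_classInner_one`, `card_inv_mul_sum_eq_zero_of_ne_one` (`|G|⁻¹Σ_G χ = 0`, `χ ≠ 1`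
  irreducible), **`classInner_add_classInner_star_character_oneFormRep_eq_of_ne_one`** (`m_χ + m_χ̄ = 2χ(1)(γ − 1) +
  Σ_t (χ(1) − |G_t|⁻¹Σ_{G_t} χ)`, (5.9)·`ℓ_i`), `exists_nat_apply_one_sub_card_inv_mul_sum_eq` (each branch term is a natural
  number `dim U − dim Fix_{G_t} U`), `apply_one_sub_card_inv_mul_sum_eq_zero_iff` (`… = 0 ⟺ G_t ≤ ker χ`),
  **`sum_support_branchDiv_apply_one_sub_eq_zero_iff`** (the branch sum vanishes iff every `G_t ≤ ker χ`),
  **`forall_stabilizer_out_iff_forall_stabilizer`** (`G_t ≤ ker χ` at the branch values iff `G_P ≤ ker χ` at every point: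
  «as `ker(U_i)` is a normal subgroup, `G_k^l ≤ ker(U_i)`»), `ramificationDiv_factor_eq_zero_iff_arithGenus_eq_one`
  (`γ = 1`: `M/N → M/G` unramified iff `g(M/N) = 1`, Riemann–Hurwitz).
* §2 COROLLARY 5.13 (`γ = 1`, `χ ∈ Irr(G)`, `χ ≠ 1`): **`classInner_add_classInner_star_eq_zero_iff_forall_stabilizer`**
  ((1) ⟺ (2)), **`classInner_add_classInner_star_eq_zero_iff_ramificationDiv_factor_eq_zero`** ((1) ⟺ (3)),
  **`classInner_add_classInner_star_eq_zero_iff_arithGenus_eq_one`** ((1) ⟺ (4)) and its `N.map G.subtype` form,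
  `finrank_range_isotypicProj_add_star_eq_zero_iff` (the same for `dim 𝓗¹(M)_χ + dim 𝓗¹(M)_χ̄ = 0`); and the remarks
  after Thm. 5.12: `exists_nat_classInner_add_classInner_star_sub_eq` (`m_χ + m_χ̄ − 2χ(1)(γ − 1) ∈ ℕ` for `χ ≠ 1`),
  **`classInner_add_classInner_star_ne_zero_of_two_le`** (`γ ≥ 2 ⟹ m_χ + m_χ̄ ≠ 0` for EVERY irreducible `χ`).

Scope (stated): the addendum «if `dim B_i = 0` then the degree of `U_i` is `1`» rests on `π_1` of the torus `S/G`
(generating vectors) and is not formalized here.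

## References

* [Rojas2007] A. M. Rojas, *Group actions on Jacobian varieties*, Rev. Mat. Iberoam. 23 (2007) 397–420, Cor. 5.11 (5.9),
  Thm. 5.12 (5.10) and the remarks following it, Cor. 5.13 with proof (held `paper:doi-10-4171-rmi-500`, pp. 415–417).
* [LangeRodriguez2022] H. Lange, R. E. Rodríguez, *Decomposition of Jacobians by Prym Varieties*, LNM 2310 (2022),
  §3.5.4 Cor. 3.5.17 (`dim B_{W_i}`), Thm. 3.1.6.
* [KopeliovichZemel2019] Y. Kopeliovich, S. Zemel, Israel J. Math. 234 (2019), Cor. 7.4 and the remark after it (the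
  cyclic case).
* [Isaacs1976] I. M. Isaacs, *Character Theory of Finite Groups* (1976), Lemma 2.19, Def. 2.20 (`ker χ`), Cor. 2.17.
-/

noncomputable section

open scoped Manifold ContDiff Topology
open Set Filter Function Complex MulAction Module
open Literature.RepresentationTheory.FiniteGroups

namespace Literature.Geometry.Kaehler

namespace RiemannSurface

/-! ### §0 The two currencies for `M/N`, `N ≤ G ≤ Aut M`, have the same genus -/

section Currency

variable {M : Type} [TopologicalSpace M] [ChartedSpace ℂ M] [IsManifold 𝓘(ℂ, ℂ) ω M]
  [CompactSpace M] [T2Space M] [PreconnectedSpace M] [Nonempty M] [Finite (autGroup M)]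
  (G : Subgroup (autGroup M))

open OrbitSurface

/-- **`g(M/N)` computed with `N` acting as a subgroup of `G`, or with `N` pushed into `Aut M`, agree**: the identity of
`M` descends to a holomorphic bijection `M/N → M/N.map(G ↪ Aut M)`. [folklore] [cite: Rojas2007, Cor. 5.13 («the genus
of `S/ker U_i`»)] -/
theorem arithGenus_orbitSurface_subgroup_eq_map (N : Subgroup ↥G) :
    arithGenus (OrbitSurface ↥N M) = arithGenus (OrbitSurface ↥(N.map G.subtype) M) := by
  set F : M → OrbitSurface ↥(N.map G.subtype) M := mk ↥(N.map G.subtype) with hFdef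
  have hF : ∀ (n : ↥N) (x : M), F (n • x) = F x := fun n x ↦ by
    have hn : (((n : ↥G) : autGroup M)) ∈ N.map G.subtype := Subgroup.mem_map_of_mem G.subtype n.2
    have hx : n • x = (⟨((n : ↥G) : autGroup M), hn⟩ : ↥(N.map G.subtype)) • x := rfl
    rw [hx, hFdef, mk_smul]
  refine arithGenus_eq_of_bijective
    (OrbitSurface.mdifferentiable_lift hF (OrbitSurface.mdifferentiable_mk (H := ↥(N.map G.subtype)) (M := M)))
    ⟨fun q₁ q₂ h ↦ ?_, fun q ↦ ?_⟩
  · induction q₁ using OrbitSurface.ind with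
    | h x =>
      induction q₂ using OrbitSurface.ind with
      | h y =>
        rw [OrbitSurface.lift_mk, OrbitSurface.lift_mk, hFdef, mk_eq_mk_iff] at h
        obtain ⟨⟨g, hg⟩, hgx⟩ := h
        obtain ⟨n, hn, rfl⟩ := Subgroup.mem_map.mp hg
        exact mk_eq_mk_iff.mpr ⟨⟨n, hn⟩, hgx⟩
  · induction q using OrbitSurface.ind with
    | h x => exact ⟨mk ↥N x, by rw [OrbitSurface.lift_mk]⟩

end Currency

/-! ### §1 The rational multiplicity of a non-trivial irreducible character and its branch terms -/

section BranchTerms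

variable {M : Type} [TopologicalSpace M] [ChartedSpace ℂ M] [IsManifold 𝓘(ℂ, ℂ) ω M]
  [CompactSpace M] [T2Space M] [PreconnectedSpace M] [Nonempty M] [Finite (autGroup M)]
  (G : Subgroup (autGroup M)) [Fintype ↥G]

open OrbitSurface

omit [TopologicalSpace M] [ChartedSpace ℂ M] [IsManifold 𝓘(ℂ, ℂ) ω M] [CompactSpace M] [T2Space M]
  [PreconnectedSpace M] [Nonempty M] [Finite (autGroup M)] in
/-- `|G|⁻¹ Σ_{g ∈ G} χ(g) = ⟨χ, 1⟩`. [cite: Isaacs1976, Cor. 2.17] -/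
theorem card_inv_mul_sum_eq_classInner_one {Γ : Type} [Group Γ] [Fintype Γ] (χ : Γ → ℂ) :
    (Fintype.card Γ : ℂ)⁻¹ * ∑ g : Γ, χ g = classInner χ 1 := by
  rw [classInner_apply]
  simp only [Pi.one_apply, mul_one]

/-- The trivial character is irreducible (tree `character_trivial_mem_irrChars`). [folklore] -/
private theorem isIrrChar_one' {Γ : Type} [Group Γ] [Finite Γ] : IsIrrChar Γ (1 : Γ → ℂ) := by
  have h1 := character_trivial_mem_irrChars (G := Γ)
  have h2 : (Representation.trivial ℂ Γ ℂ).character = 1 := by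
    funext x; simp [Representation.character]
  rwa [h2] at h1

omit [TopologicalSpace M] [ChartedSpace ℂ M] [IsManifold 𝓘(ℂ, ℂ) ω M] [CompactSpace M] [T2Space M]
  [PreconnectedSpace M] [Nonempty M] [Finite (autGroup M)] in
/-- **`|G|⁻¹ Σ_{g ∈ G} χ(g) = 0` for a non-trivial irreducible character** (`dim U^G = ⟨χ, 1⟩ = 0`).
[cite: Isaacs1976, Cor. 2.17] [cite: Rojas2007, Cor. 5.11 (5.9) («non trivial»)] -/
theorem card_inv_mul_sum_eq_zero_of_ne_one {Γ : Type} [Group Γ] [Fintype Γ] {χ : Γ → ℂ} (hχ : IsIrrChar Γ χ)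
    (h1 : χ ≠ 1) : (Fintype.card Γ : ℂ)⁻¹ * ∑ g : Γ, χ g = 0 := by
  classical
  rw [card_inv_mul_sum_eq_classInner_one, hχ.classInner_eq isIrrChar_one', if_neg h1]

open Classical in
/-- **COROLLARY 5.11 (5.9) times `ℓ_i`, at `T_0`: for a NON-TRIVIAL irreducible `χ`,
`m_χ + m_χ̄ = 2χ(1)(γ − 1) + Σ_t (χ(1) − |G_t|⁻¹ Σ_{h ∈ G_t} χ(h))`** (`= 2 dim U_i (γ − 1) + Σ_k (dim U_i − dim Fix_{G_k} U_i)`).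
[cite: Rojas2007, Cor. 5.11 (5.9), Thm. 5.10 (5.4)] [cite: LangeRodriguez2022, §3.5.4 Cor. 3.5.17] -/
theorem classInner_add_classInner_star_character_oneFormRep_eq_of_ne_one [DecidableEq ↥G] {χ : ↥G → ℂ}
    (hχ : IsIrrChar ↥G χ) (h1 : χ ≠ 1) :
    classInner χ (Representation.character ((oneFormRep M).comp G.subtype)) +
        classInner (star χ) (Representation.character ((oneFormRep M).comp G.subtype)) =
      2 * χ 1 * ((arithGenus (OrbitSurface G M) : ℂ) - 1) +
        ∑ q ∈ (branchDiv (mk G : M → OrbitSurface G M)).support,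
          (χ 1 - (Fintype.card ↥(stabilizer G q.out) : ℂ)⁻¹ * ∑ h : ↥(stabilizer G q.out), χ h) := by
  rw [classInner_add_classInner_star_character_oneFormRep_eq G hχ, card_inv_mul_sum_eq_zero_of_ne_one hχ h1, mul_zero,
    zero_add]

omit [TopologicalSpace M] [ChartedSpace ℂ M] [IsManifold 𝓘(ℂ, ℂ) ω M] [CompactSpace M] [T2Space M]
  [PreconnectedSpace M] [Nonempty M] [Finite (autGroup M)] [Fintype ↥G] in
/-- **Each branch term is a natural number: `χ(1) − |K|⁻¹ Σ_{h ∈ K} χ(h) = dim U − dim U^K ∈ ℕ`** for a character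
`χ = χ_U` and a subgroup `K`. [cite: Rojas2007, Thm. 5.12 (5.10) («`dim U_i − dim Fix_{G_k} U_i`»)]
[cite: LangeRodriguez2022, §2.8 (2.18)] -/
theorem exists_nat_apply_one_sub_card_inv_mul_sum_eq {Γ : Type} [Group Γ] [Fintype Γ] {χ : Γ → ℂ}
    (hχ : IsCharacter Γ χ) (K : Subgroup Γ) [Fintype ↥K] :
    ∃ n : ℕ, χ 1 - (Fintype.card ↥K : ℂ)⁻¹ * ∑ h : ↥K, χ h = n := by
  obtain ⟨W, _, _, _, τ, rfl⟩ := hχ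
  rw [card_inv_mul_sum_subgroup_character_eq_finrank_invariants K τ, Representation.char_one]
  refine ⟨finrank ℂ W - finrank ℂ ↥(Representation.invariants (τ.comp K.subtype)), ?_⟩
  rw [Nat.cast_sub (Submodule.finrank_le _)]

omit [TopologicalSpace M] [ChartedSpace ℂ M] [IsManifold 𝓘(ℂ, ℂ) ω M] [CompactSpace M] [T2Space M]
  [PreconnectedSpace M] [Nonempty M] [Finite (autGroup M)] [Fintype ↥G] in
/-- **`χ(1) − |K|⁻¹ Σ_{h ∈ K} χ(h) = 0 ⟺ K ≤ ker χ`** (`χ(h) = χ(1)` on `K`; «`dim(U_i) = dim Fix_{G_k}(U_i)` […]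
Therefore `G_k ≤ ker(U_i)`»). [cite: Rojas2007, Cor. 5.13 (proof)] [cite: Isaacs1976, Lemma 2.19, Def. 2.20] -/
theorem apply_one_sub_card_inv_mul_sum_eq_zero_iff {Γ : Type} [Group Γ] [Fintype Γ] {χ : Γ → ℂ}
    (hχ : IsCharacter Γ χ) (K : Subgroup Γ) [Fintype ↥K] :
    χ 1 - (Fintype.card ↥K : ℂ)⁻¹ * ∑ h : ↥K, χ h = 0 ↔ ∀ h : ↥K, χ h = χ 1 := by
  obtain ⟨W, _, _, _, τ, rfl⟩ := id hχ
  rw [sub_eq_zero, eq_comm]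
  exact card_inv_mul_sum_eq_apply_one_iff (V := W) hχ

open Classical in
omit [CompactSpace M] [Nonempty M] [Fintype ↥G] in
/-- **The branch sum `Σ_t (χ(1) − |G_t|⁻¹ Σ_{G_t} χ)` vanishes iff every branch stabilizer `G_t` lies in `ker χ`**
(a sum of natural numbers). [cite: Rojas2007, Cor. 5.13 (proof: (1) ⟹ (2))] -/
theorem sum_support_branchDiv_apply_one_sub_eq_zero_iff [Fintype ↥G] {χ : ↥G → ℂ} (hχ : IsCharacter ↥G χ) :
    ∑ q ∈ (branchDiv (mk G : M → OrbitSurface G M)).support,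
        (χ 1 - (Fintype.card ↥(stabilizer G q.out) : ℂ)⁻¹ * ∑ h : ↥(stabilizer G q.out), χ h) = 0 ↔
      ∀ q ∈ (branchDiv (mk G : M → OrbitSurface G M)).support, ∀ h : ↥(stabilizer G q.out), χ h = χ 1 := by
  choose n hn using fun q : OrbitSurface G M ↦ exists_nat_apply_one_sub_card_inv_mul_sum_eq hχ (stabilizer G q.out)
  simp_rw [hn, ← apply_one_sub_card_inv_mul_sum_eq_zero_iff hχ, hn]
  rw [← Nat.cast_sum, Nat.cast_eq_zero, Finset.sum_eq_zero_iff]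
  simp only [Nat.cast_eq_zero]

omit [Fintype ↥G] in
/-- **«As `ker(U_i)` is a normal subgroup of `G`, `G_k^l ≤ ker(U_i)` for all `l ∈ G`»: for a class function `χ`, the
branch stabilizers `G_t = G_{q_t.out}` lie in `ker χ` iff EVERY stabilizer `G_P`, `P ∈ M`, does** (stabilizers along a
fibre are conjugate; points off the ramification locus have `G_P = 1`). [cite: Rojas2007, Cor. 5.13 (proof), Lemma 3.1] -/
theorem forall_stabilizer_out_iff_forall_stabilizer {χ : ↥G → ℂ} (hcl : IsClassFun χ) :
    (∀ q ∈ (branchDiv (mk G : M → OrbitSurface G M)).support, ∀ h : ↥(stabilizer G q.out), χ h = χ 1) ↔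
      ∀ (P : M) (h : ↥(stabilizer G P)), χ h = χ 1 := by
  refine ⟨fun hq P h ↦ ?_, fun hP q _ h ↦ hP q.out h⟩
  by_cases hbot : stabilizer G P = ⊥
  · have h1 : (h : ↥G) = 1 := Subgroup.mem_bot.mp (hbot.le h.2)
    rw [h1]
  · -- `P` is a ramification point, `q = π P` a branch value, `q.out = g • P` for some `g`, `G_{q.out} = g G_P g⁻¹`
    have hq' : mk G P ∈ (branchDiv (mk G : M → OrbitSurface G M)).support :=
      (mem_support_ramificationDiv_iff_mk_mem_support_branchDiv G P).mp
        (mem_support_ramificationDiv_of_stabilizer_eq G hbot rfl)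
    obtain ⟨g, hg⟩ := mk_eq_mk_iff.mp ((OrbitSurface.mk_out (H := ↥G) (mk G P : OrbitSurface G M)).trans rfl).symm
    -- `hg : g • P = (mk G P).out`
    have hmem : g * (h : ↥G) * g⁻¹ ∈ stabilizer G (mk G P : OrbitSurface G M).out := by
      rw [← hg, mem_stabilizer_iff, mul_smul, mul_smul, inv_smul_smul]
      congr 1
      exact mem_stabilizer_iff.mp h.2
    have key := hq (mk G P) hq' ⟨_, hmem⟩
    rwa [Subgroup.coe_mk, hcl] at key

variable {G} in
omit [Fintype ↥G] in
/-- For `0 ≤ D`: `deg D = 0 ⟺ D = 0`. [folklore] -/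
private theorem degree_eq_zero_iff_of_nonneg {α : Type*} {D : α →₀ ℤ} (hD : 0 ≤ D) : Finsupp.degree D = 0 ↔ D = 0 := by
  refine ⟨fun h ↦ ?_, fun h ↦ by rw [h, map_zero]⟩
  rw [Finsupp.degree_apply] at h
  have hle : ∀ p ∈ D.support, 0 ≤ D p := fun p _ ↦ hD p
  ext p
  by_contra hp
  have hps : p ∈ D.support := Finsupp.mem_support_iff.mpr hp
  have := (Finset.sum_eq_zero_iff_of_nonneg hle).mp h p hps
  exact hp this

omit [Fintype ↥G] in
/-- **For `γ = g(M/G) = 1`, the cover `M/N → M/G` is unramified iff `g(M/N) = 1`** («Computing Riemann-Hurwitz for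
this covering, we obtain that the genus of `S/ker(U_i)` is one»: `2g(M/N) − 2 = [G:N]·0 + deg R`).
[cite: Rojas2007, Cor. 5.13 (proof: (3) ⟺ (4))] [cite: LangeRodriguez2022, Thm. 3.1.6] -/
theorem ramificationDiv_factor_eq_zero_iff_arithGenus_eq_one (hγ : arithGenus (OrbitSurface G M) = 1)
    (N : Subgroup ↥G) :
    ramificationDiv (factor N : OrbitSurface ↥N M → OrbitSurface (↥G) M) = 0 ↔ arithGenus (OrbitSurface ↥N M) = 1 := by
  have hRH := OrbitSurface.two_mul_arithGenus_sub_two_eq_factor (H := ↥G) (M := M) N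
  rw [hγ] at hRH
  push_cast at hRH
  rw [← degree_eq_zero_iff_of_nonneg (ramificationDiv_nonneg (mdifferentiable_factor N) (exists_factor_ne N))]
  constructor
  · intro h0
    rw [h0] at hRH
    have : (arithGenus (OrbitSurface ↥N M) : ℤ) = 1 := by linarith
    exact_mod_cast this
  · intro h1
    rw [h1] at hRH
    push_cast at hRH
    linarith

end BranchTerms

/-! ### §2 COROLLARY 5.13 (`γ = 1`) and the remarks after THEOREM 5.12 (`γ ≥ 2`) -/

section GenusOne

variable {M : Type} [TopologicalSpace M] [ChartedSpace ℂ M] [IsManifold 𝓘(ℂ, ℂ) ω M]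
  [CompactSpace M] [T2Space M] [PreconnectedSpace M] [Nonempty M] [Finite (autGroup M)]
  (G : Subgroup (autGroup M)) [Fintype ↥G] [DecidableEq ↥G]

open OrbitSurface

/-- **COROLLARY 5.13, (1) ⟺ (2): for `γ = g(M/G) = 1` and a non-trivial irreducible `χ`, the rational multiplicity
`m_χ + m_χ̄` vanishes iff every stabilizer `G_P` lies in `ker χ`** (`χ(h) = χ(1)` for all `h ∈ G_P`, `P ∈ M`).
[cite: Rojas2007, Cor. 5.13 (1) ⟺ (2)] -/
theorem classInner_add_classInner_star_eq_zero_iff_forall_stabilizer (hγ : arithGenus (OrbitSurface G M) = 1)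
    {χ : ↥G → ℂ} (hχ : IsIrrChar ↥G χ) (h1 : χ ≠ 1) :
    classInner χ (Representation.character ((oneFormRep M).comp G.subtype)) +
        classInner (star χ) (Representation.character ((oneFormRep M).comp G.subtype)) = 0 ↔
      ∀ (P : M) (h : ↥(stabilizer G P)), χ h = χ 1 := by
  classical
  rw [classInner_add_classInner_star_character_oneFormRep_eq_of_ne_one G hχ h1, hγ, Nat.cast_one, sub_self, mul_zero,
    zero_add, sum_support_branchDiv_apply_one_sub_eq_zero_iff G hχ.isCharacter,
    forall_stabilizer_out_iff_forall_stabilizer G hχ.isCharacter.isClassFun]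

/-- **COROLLARY 5.13, (1) ⟺ (3): … iff the cover `M/ker χ → M/G` is unramified** (`N = ker χ` entered as the subgroup
with `g ∈ N ⟺ χ(g) = χ(1)`; «the ramification divisors for the coverings `π_G` and `π_{ker(U_i)}` coincide»).
[cite: Rojas2007, Cor. 5.13 (1) ⟺ (3)] [cite: Isaacs1976, Lemma 2.19] -/
theorem classInner_add_classInner_star_eq_zero_iff_ramificationDiv_factor_eq_zero
    (hγ : arithGenus (OrbitSurface G M) = 1) {χ : ↥G → ℂ} (hχ : IsIrrChar ↥G χ) (h1 : χ ≠ 1)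
    {N : Subgroup ↥G} (hN : ∀ g : ↥G, g ∈ N ↔ χ g = χ 1) :
    classInner χ (Representation.character ((oneFormRep M).comp G.subtype)) +
        classInner (star χ) (Representation.character ((oneFormRep M).comp G.subtype)) = 0 ↔
      ramificationDiv (factor N : OrbitSurface ↥N M → OrbitSurface (↥G) M) = 0 := by
  rw [classInner_add_classInner_star_eq_zero_iff_forall_stabilizer G hγ hχ h1, ramificationDiv_factor_eq_zero_iff]
  refine ⟨fun h P g hg ↦ (hN g).mpr (h P ⟨g, hg⟩), fun h P g ↦ (hN g).mp (h P g.2)⟩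

/-- **COROLLARY 5.13, (1) ⟺ (4): … iff `g(M/ker χ) = 1`.** [cite: Rojas2007, Cor. 5.13 (1) ⟺ (4)] -/
theorem classInner_add_classInner_star_eq_zero_iff_arithGenus_eq_one
    (hγ : arithGenus (OrbitSurface G M) = 1) {χ : ↥G → ℂ} (hχ : IsIrrChar ↥G χ) (h1 : χ ≠ 1)
    {N : Subgroup ↥G} (hN : ∀ g : ↥G, g ∈ N ↔ χ g = χ 1) :
    classInner χ (Representation.character ((oneFormRep M).comp G.subtype)) +
        classInner (star χ) (Representation.character ((oneFormRep M).comp G.subtype)) = 0 ↔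
      arithGenus (OrbitSurface ↥N M) = 1 := by
  rw [classInner_add_classInner_star_eq_zero_iff_ramificationDiv_factor_eq_zero G hγ hχ h1 hN,
    ramificationDiv_factor_eq_zero_iff_arithGenus_eq_one G hγ N]

/-- COROLLARY 5.13, (1) ⟺ (4), with `ker χ` pushed into `Aut M` (the currency of `RiemannSurfaceIsotypicDecomposition`
§6 / `RiemannSurfaceChevalleyWeilPositivity`). [cite: Rojas2007, Cor. 5.13 (1) ⟺ (4)] -/
theorem classInner_add_classInner_star_eq_zero_iff_arithGenus_map_eq_one
    (hγ : arithGenus (OrbitSurface G M) = 1) {χ : ↥G → ℂ} (hχ : IsIrrChar ↥G χ) (h1 : χ ≠ 1)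
    {N : Subgroup ↥G} (hN : ∀ g : ↥G, g ∈ N ↔ χ g = χ 1) :
    classInner χ (Representation.character ((oneFormRep M).comp G.subtype)) +
        classInner (star χ) (Representation.character ((oneFormRep M).comp G.subtype)) = 0 ↔
      arithGenus (OrbitSurface ↥(N.map G.subtype) M) = 1 := by
  rw [classInner_add_classInner_star_eq_zero_iff_arithGenus_eq_one G hγ hχ h1 hN, arithGenus_orbitSurface_subgroup_eq_map]

/-- **COROLLARY 5.13 for the dimensions: `dim 𝓗¹(M)_χ + dim 𝓗¹(M)_χ̄ = 0 ⟺ every stabilizer lies in `ker χ`**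
(`dim 𝓗¹(M)_χ = χ(1)·m_χ`). [cite: Rojas2007, Cor. 5.13, Thm. 5.12 (5.10)] -/
theorem finrank_range_isotypicProj_add_star_eq_zero_iff (hγ : arithGenus (OrbitSurface G M) = 1)
    {χ : ↥G → ℂ} (hχ : IsIrrChar ↥G χ) (h1 : χ ≠ 1) :
    finrank ℂ ↥(LinearMap.range (isotypicProj ((oneFormRep M).comp G.subtype) χ)) +
        finrank ℂ ↥(LinearMap.range (isotypicProj ((oneFormRep M).comp G.subtype) (star χ))) = 0 ↔
      ∀ (P : M) (h : ↥(stabilizer G P)), χ h = χ 1 := by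
  haveI : Module.Finite ℂ ↥(holomorphicOneForms M) := moduleFinite_holomorphicOneForms
  rw [← classInner_add_classInner_star_eq_zero_iff_forall_stabilizer G hγ hχ h1]
  have h1' : (star χ) 1 = χ 1 := apply_one_of_mem_galoisClass (star_mem_galoisClass hχ.isCharacter)
  have hsum : ((finrank ℂ ↥(LinearMap.range (isotypicProj ((oneFormRep M).comp G.subtype) χ)) +
      finrank ℂ ↥(LinearMap.range (isotypicProj ((oneFormRep M).comp G.subtype) (star χ))) : ℕ) : ℂ) =
      χ 1 * (classInner χ (Representation.character ((oneFormRep M).comp G.subtype)) +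
        classInner (star χ) (Representation.character ((oneFormRep M).comp G.subtype))) := by
    rw [Nat.cast_add, finrank_range_isotypicProj _ hχ, finrank_range_isotypicProj _ hχ.star, h1', mul_add]
  rw [← Nat.cast_eq_zero (R := ℂ), hsum, mul_eq_zero, or_iff_right hχ.apply_one_ne_zero]

/-- **«If `γ ≥ 2`, then the dimension of each subvariety `B_i` […] is positive»: `m_χ + m_χ̄ − 2χ(1)(γ − 1)` is a natural
number**, i.e. `m_χ + m_χ̄ ≥ 2χ(1)(γ − 1)`, for every non-trivial irreducible `χ` (the branch terms are `≥ 0`).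
[cite: Rojas2007, Thm. 5.12 (remark following it), Cor. 5.11] [cite: LangeRodriguez2022, §3.5.4 Cor. 3.5.17] -/
theorem exists_nat_classInner_add_classInner_star_sub_eq {χ : ↥G → ℂ} (hχ : IsIrrChar ↥G χ) (h1 : χ ≠ 1) :
    ∃ n : ℕ, classInner χ (Representation.character ((oneFormRep M).comp G.subtype)) +
        classInner (star χ) (Representation.character ((oneFormRep M).comp G.subtype)) -
        2 * χ 1 * ((arithGenus (OrbitSurface G M) : ℂ) - 1) = n := by
  classical
  choose n hn using fun q : OrbitSurface G M ↦
    exists_nat_apply_one_sub_card_inv_mul_sum_eq hχ.isCharacter (stabilizer G q.out)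
  refine ⟨∑ q ∈ (branchDiv (mk G : M → OrbitSurface G M)).support, n q, ?_⟩
  rw [classInner_add_classInner_star_character_oneFormRep_eq_of_ne_one G hχ h1, add_sub_cancel_left, Nat.cast_sum]
  exact Finset.sum_congr rfl fun q _ ↦ hn q

/-- **«If `γ ≥ 2`, then the dimension of each subvariety `B_i` in the `G`-equivariant decomposition of `JS` is
positive»**, at `T_0`: for `g(M/G) ≥ 2` and every irreducible `χ`, `m_χ + m_χ̄ ≠ 0` (indeed `≥ 2χ(1)` for `χ ≠ 1`, and
`m_1 = γ`). [cite: Rojas2007, Thm. 5.12 (remark following it)] [cite: LangeRodriguez2022, §3.5.4 Cor. 3.5.17] -/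
theorem classInner_add_classInner_star_ne_zero_of_two_le (hγ : 2 ≤ arithGenus (OrbitSurface G M))
    {χ : ↥G → ℂ} (hχ : IsIrrChar ↥G χ) :
    classInner χ (Representation.character ((oneFormRep M).comp G.subtype)) +
        classInner (star χ) (Representation.character ((oneFormRep M).comp G.subtype)) ≠ 0 := by
  classical
  haveI : Module.Finite ℂ ↥(holomorphicOneForms M) := moduleFinite_holomorphicOneForms
  by_cases h1 : χ = 1
  · -- `m_1 + m_1̄ = 2γ`
    subst h1
    rw [star_one, ← two_mul, classInner_one_character_oneFormRep G]
    have hγ' : (arithGenus (OrbitSurface G M) : ℂ) ≠ 0 := Nat.cast_ne_zero.mpr (by omega)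
    exact mul_ne_zero two_ne_zero hγ'
  · obtain ⟨n, hn⟩ := exists_nat_classInner_add_classInner_star_sub_eq G hχ h1
    rw [sub_eq_iff_eq_add] at hn
    rw [hn]
    -- `n + 2χ(1)(γ − 1)` with `χ(1) ≥ 1`, `γ − 1 ≥ 1`
    obtain ⟨d, hd⟩ : ∃ d : ℕ, χ 1 = d := by
      obtain ⟨V, _, _, _, ρ, _, rfl⟩ := hχ
      exact ⟨finrank ℂ V, Representation.char_one ρ⟩
    have hd0 : d ≠ 0 := fun h ↦ hχ.apply_one_ne_zero (by rw [hd, h, Nat.cast_zero])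
    obtain ⟨k, hk⟩ : ∃ k : ℕ, arithGenus (OrbitSurface G M) = k + 2 := ⟨_, (Nat.sub_add_cancel hγ).symm⟩
    rw [hd, hk]
    push_cast
    have : ((n : ℂ) + 2 * d * ((k : ℂ) + 2 - 1)) = ((n + 2 * d * (k + 1) : ℕ) : ℂ) := by push_cast; ring
    rw [this, Nat.cast_ne_zero]
    have : 0 < 2 * d * (k + 1) := by positivity
    omega

end GenusOne

end RiemannSurface

end Literature.Geometry.Kaehler

end
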